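import Literature.MathematicalPhysics.QuantumLattice.FreeFermiGasPairGramBounds
import HarnessLib

/-!
# Triangle bounds for pair operators: pair amplitude against occupation deviations

Family `hubbard` / topic `MathematicalPhysics/QuantumLattice`. For ANY vector `ψ` of the fermionic
Fock space of the torus `(ℤ/Lℤ)²`, the hard-core pair modes `b_k = c_{-k↓} c_{k↑}` (`pairMode`) and
the pair operators `B(ĝ,S) = Σ_{k∈S} ĝ(k) b_k` (`pairOperator`, real form factor `ĝ`):

* **The pair-operator commutator** (`pairOperator_mul_conjTranspose_eq`):
  `B(ĝ,S) B(ĝ,S)† = B(ĝ,S)† B(ĝ,S) + Σ_{k∈S} ĝ(k)² (1 - n_{k↑} - n_{-k↓})` (the cross terms of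
  `[b_k, b_{k'}†] = δ_{kk'}(1 - n_{k↑} - n_{-k↓})` cancel).
* **Triangle bounds** (`norm_toLp_pairOperator_mulVec_le`, `norm_toLp_conjTranspose_pairOperator_mulVec_le`):
  `‖B(ĝ,S) ψ‖ ≤ Σ_{k∈S} |ĝ(k)| ‖b_k ψ‖` and `‖B(ĝ,S)† ψ‖ ≤ Σ_{k∈S} |ĝ(k)| ‖b_k† ψ‖`, with
  `‖b_k ψ‖² = ⟨n_{k↑} n_{-k↓}⟩ ≤ x_k` and `‖b_k† ψ‖² = ⟨(1-n_{k↑})(1-n_{-k↓})⟩ ≤ 1 - x_k`,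
  `x_k = Re ⟨ψ, n_{k↑} ψ⟩` (unit `ψ`).
* **Pair amplitude against deviations** (`sqrt_re_expect_pairOperator_le_deviation`): for every
  finite set `F` of momenta ("Fermi sea") and `|ĝ| ≤ G`,
  `√(Re ⟨ψ, B(ĝ)† B(ĝ) ψ⟩) ≤ G Σ_{k∉F} √x_k + G Σ_{k∈F} √(1 - x_k) + G √(Σ_{k∈F} x_k)`
  (`B(ĝ) = B(ĝ, univ) = B(ĝ, Fᶜ) + B(ĝ, F)`; the first piece by the triangle bound, the second
  through its adjoint by the commutator identity), and its `d`-wave form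
  (`sqrt_le_deviation_of_le_re_expect_pairField_dWave`): `Re ⟨ψ, Δ_d†Δ_d ψ⟩ ≥ a L⁴` forces
  `√(a/8) · L² ≤ 2 Σ_{k∉F} √x_k + 2 Σ_{k∈F} √(1 - x_k) + 2 √(Σ_{k∈F} x_k)` (`Δ_d = -2√2 B(ĝ_d)`,
  `|ĝ_d| ≤ 2`).

Compared with the pair Gram bound `‖⟨b_k† b_{k'}⟩‖ ≤ (u_k v_k u_{k'} v_{k'})^{1/4}`
(`FreeFermiGasPairGramBounds.lean`), which charges a smeared level only `(x_k(1-x_k))^{1/4}`, the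
triangle bound charges it `√x_k` above and `√(1-x_k)` below the Fermi set — the Bardeen–Cooper–
Schrieffer amplitude `u_k v_k` up to constants; the consumer `FreeFermiGasPairingCostOptimal.lean`
turns this into the pairing-cost rate `a^{3/2}` (uniform density of states) resp. `a/log(1/a)`.

Sources: J. Bardeen, L. N. Cooper, J. R. Schrieffer, Phys. Rev. 108 (1957) 1175, §II (pair
amplitude `Σ_k u_k v_k` and its kinetic cost); C. N. Yang, Rev. Mod. Phys. 34 (1962) 694, §3;
J. von Delft, D. C. Ralph, Phys. Rep. 345 (2001) 61, §4.2.3 (hard-core pair algebra). Folklore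
finite-dimensional statements; no named facts, no definitions.

## Mathlib / tree search

Tree: `pairMode_commutator_conjTranspose`, `conjTranspose_pairOperator_mul_pairOperator`,
`conjTranspose_pairMode_mul_self`, `pairMode_mul_conjTranspose_self` (the Summits-side helper file
`Theorems/JosephsonMirrorFreeLayersPairBounds.lean` has the commutator sum and blockwise weighted
Cauchy–Schwarz versions of the regional bounds, `‖B_S w‖² ≤ (4|S|/Λ) Σ_S ξ_k⟨n_{k↑}⟩`; the pointwise
triangle bounds here are its `|S|`-free sharpening, stated in `Literature` for reuse),
`star_dotProduct_conjTranspose_mul_mulVec`, `norm_toLp_sq_eq_re`, `re_expect_pairPresent_mem_Icc`,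
`re_expect_pairAbsent_mem_Icc`, `re_expect_momentumNumber_mem_Icc`,
`conjTranspose_pairField_dWave_mul_self`. Mathlib: `WithLp.toLp_sum`, `WithLp.toLp_smul`,
`norm_sum_le`, `norm_smul`, `Real.sqrt_le_sqrt`, `Real.le_sqrt`, `Finset.sum_comm`.
-/

noncomputable section

namespace Literature.MathematicalPhysics.QuantumLattice

open Matrix Finset Literature.Probability.LatticeModels
open scoped ComplexOrder ComplexConjugate

variable {L : ℕ} [NeZero L]

/-! ### The pair-operator commutator identity -/

/-- **Pair-operator commutator.** `B(ĝ,S) B(ĝ,S)† = B(ĝ,S)† B(ĝ,S) + Σ_{k∈S} ĝ(k)² (1 - n_{k↑} - n_{-k↓})`: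
expand both products over `k, k' ∈ S` and use `b_k b_{k'}† = b_{k'}† b_k + δ_{kk'}(1 - n_{k↑} - n_{-k↓})`
(`pairMode_commutator_conjTranspose`). von Delft–Ralph (2001) §4.2.3. [folklore] -/
theorem pairOperator_mul_conjTranspose_eq (ĝ : TorusSite 2 L → ℝ) (S : Finset (TorusSite 2 L)) :
    pairOperator ĝ S * (pairOperator ĝ S)ᴴ =
      (pairOperator ĝ S)ᴴ * pairOperator ĝ S +
        ∑ k ∈ S, ((ĝ k : ℂ) ^ 2) • (1 - momentumNumber k 0 - momentumNumber (-k) 1) := by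
  have hcomm : ∀ k k' : TorusSite 2 L, pairMode k * (pairMode k')ᴴ =
      (pairMode k')ᴴ * pairMode k +
        (if k = k' then 1 - momentumNumber k 0 - momentumNumber (-k) 1 else 0) := by
    intro k k'
    rw [← pairMode_commutator_conjTranspose k k']
    abel
  -- `B† = Σ_k ĝ(k) b_k†` (also `Theorems.JosephsonMirror.pairOperator_conjTranspose_eq_sum`, Summits-side)
  have hct : (pairOperator ĝ S)ᴴ = ∑ k ∈ S, (ĝ k : ℂ) • (pairMode k)ᴴ := by
    simp only [pairOperator, conjTranspose_sum, conjTranspose_smul, Complex.star_def,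
      Complex.conj_ofReal]
  rw [conjTranspose_pairOperator_mul_pairOperator, hct, pairOperator, Finset.sum_mul_sum]
  have hterm : ∀ k ∈ S, ∑ k' ∈ S, (ĝ k : ℂ) • pairMode k * ((ĝ k' : ℂ) • (pairMode k')ᴴ) =
      ∑ k' ∈ S, ((ĝ k' : ℂ) * (ĝ k : ℂ)) • ((pairMode k')ᴴ * pairMode k) +
        ((ĝ k : ℂ) ^ 2) • (1 - momentumNumber k 0 - momentumNumber (-k) 1) := by
    intro k hk
    have : ∀ k' ∈ S, (ĝ k : ℂ) • pairMode k * ((ĝ k' : ℂ) • (pairMode k')ᴴ) =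
        ((ĝ k' : ℂ) * (ĝ k : ℂ)) • ((pairMode k')ᴴ * pairMode k) +
          ((ĝ k : ℂ) * (ĝ k' : ℂ)) •
            (if k = k' then 1 - momentumNumber k 0 - momentumNumber (-k) 1 else 0) := by
      intro k' _
      rw [smul_mul_smul_comm, hcomm k k', smul_add, mul_comm (ĝ k' : ℂ)]
    rw [Finset.sum_congr rfl this, Finset.sum_add_distrib]
    congr 1
    simp_rw [smul_ite, smul_zero]
    rw [Finset.sum_ite_eq, if_pos hk, sq]
  rw [Finset.sum_congr rfl hterm, Finset.sum_add_distrib, Finset.sum_comm]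

/-- Expectation form of the commutator identity:
`Re ⟨ψ, B†B ψ⟩ = Re ⟨ψ, BB† ψ⟩ + Σ_{k∈S} ĝ(k)² (x_k + y_k - ‖ψ‖²)`, `x_k = Re⟨n_{k↑}⟩`,
`y_k = Re⟨n_{-k↓}⟩`. [folklore] -/
theorem re_expect_conjTranspose_pairOperator_mul_eq (ĝ : TorusSite 2 L → ℝ) (S : Finset (TorusSite 2 L))
    (ψ : Fock (Orb (FermionTorus 2 L))) :
    (star ψ ⬝ᵥ (((pairOperator ĝ S)ᴴ * pairOperator ĝ S) *ᵥ ψ)).re =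
      (star ψ ⬝ᵥ ((pairOperator ĝ S * (pairOperator ĝ S)ᴴ) *ᵥ ψ)).re +
        ∑ k ∈ S, ĝ k ^ 2 * ((star ψ ⬝ᵥ (momentumNumber k 0 *ᵥ ψ)).re +
          (star ψ ⬝ᵥ (momentumNumber (-k) 1 *ᵥ ψ)).re - (star ψ ⬝ᵥ ψ).re) := by
  rw [pairOperator_mul_conjTranspose_eq, add_mulVec, dotProduct_add, Complex.add_re, Matrix.sum_mulVec,
    dotProduct_sum, Complex.re_sum]
  have : ∀ k ∈ S, (star ψ ⬝ᵥ ((((ĝ k : ℂ) ^ 2) • (1 - momentumNumber k 0 - momentumNumber (-k) 1)) *ᵥ ψ)).re =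
      ĝ k ^ 2 * ((star ψ ⬝ᵥ ψ).re - (star ψ ⬝ᵥ (momentumNumber k 0 *ᵥ ψ)).re -
        (star ψ ⬝ᵥ (momentumNumber (-k) 1 *ᵥ ψ)).re) := by
    intro k _
    rw [Matrix.smul_mulVec, dotProduct_smul, smul_eq_mul, ← Complex.ofReal_pow, Complex.re_ofReal_mul,
      sub_mulVec, sub_mulVec, one_mulVec, dotProduct_sub, dotProduct_sub, Complex.sub_re, Complex.sub_re]
  rw [Finset.sum_congr rfl this]
  have hs : ∑ k ∈ S, ĝ k ^ 2 * ((star ψ ⬝ᵥ ψ).re - (star ψ ⬝ᵥ (momentumNumber k 0 *ᵥ ψ)).re -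
        (star ψ ⬝ᵥ (momentumNumber (-k) 1 *ᵥ ψ)).re) +
      ∑ k ∈ S, ĝ k ^ 2 * ((star ψ ⬝ᵥ (momentumNumber k 0 *ᵥ ψ)).re +
          (star ψ ⬝ᵥ (momentumNumber (-k) 1 *ᵥ ψ)).re - (star ψ ⬝ᵥ ψ).re) = 0 := by
    rw [← Finset.sum_add_distrib]
    exact Finset.sum_eq_zero fun k _ => by ring
  linarith

/-! ### Triangle bounds -/

/-- `‖b_k ψ‖² = Re ⟨ψ, n_{k↑} n_{-k↓} ψ⟩` (`b_k† b_k = n_{k↑} n_{-k↓}`). [folklore] -/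
theorem norm_toLp_pairMode_mulVec_sq (k : TorusSite 2 L) (ψ : Fock (Orb (FermionTorus 2 L))) :
    ‖(WithLp.toLp 2 (pairMode k *ᵥ ψ) : EuclideanSpace ℂ (Finset (Orb (FermionTorus 2 L))))‖ ^ 2 =
      (star ψ ⬝ᵥ ((momentumNumber k 0 * momentumNumber (-k) 1) *ᵥ ψ)).re := by
  rw [norm_toLp_sq_eq_re, ← star_dotProduct_conjTranspose_mul_mulVec, conjTranspose_pairMode_mul_self]

/-- `‖b_k† ψ‖² = Re ⟨ψ, (1 - n_{k↑})(1 - n_{-k↓}) ψ⟩` (`b_k b_k† = (1-n_{k↑})(1-n_{-k↓})`). [folklore] -/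
theorem norm_toLp_conjTranspose_pairMode_mulVec_sq (k : TorusSite 2 L)
    (ψ : Fock (Orb (FermionTorus 2 L))) :
    ‖(WithLp.toLp 2 ((pairMode k)ᴴ *ᵥ ψ) : EuclideanSpace ℂ (Finset (Orb (FermionTorus 2 L))))‖ ^ 2 =
      (star ψ ⬝ᵥ (((1 - momentumNumber k 0) * (1 - momentumNumber (-k) 1)) *ᵥ ψ)).re := by
  rw [norm_toLp_sq_eq_re, ← star_dotProduct_conjTranspose_mul_mulVec, conjTranspose_conjTranspose,
    pairMode_mul_conjTranspose_self]

/-- `‖b_k ψ‖ ≤ √x_k`, `x_k = Re ⟨ψ, n_{k↑} ψ⟩`. [folklore] -/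
theorem norm_toLp_pairMode_mulVec_le_sqrt (k : TorusSite 2 L) (ψ : Fock (Orb (FermionTorus 2 L))) :
    ‖(WithLp.toLp 2 (pairMode k *ᵥ ψ) : EuclideanSpace ℂ (Finset (Orb (FermionTorus 2 L))))‖ ≤
      Real.sqrt ((star ψ ⬝ᵥ (momentumNumber k 0 *ᵥ ψ)).re) := by
  refine Real.le_sqrt_of_sq_le ?_
  rw [norm_toLp_pairMode_mulVec_sq]
  exact (re_expect_pairPresent_mem_Icc k ψ).2

/-- `‖b_k† ψ‖ ≤ √(1 - x_k)` for a unit vector `ψ`, `x_k = Re ⟨ψ, n_{k↑} ψ⟩`. [folklore] -/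
theorem norm_toLp_conjTranspose_pairMode_mulVec_le_sqrt (k : TorusSite 2 L)
    {ψ : Fock (Orb (FermionTorus 2 L))} (h1 : star ψ ⬝ᵥ ψ = 1) :
    ‖(WithLp.toLp 2 ((pairMode k)ᴴ *ᵥ ψ) : EuclideanSpace ℂ (Finset (Orb (FermionTorus 2 L))))‖ ≤
      Real.sqrt (1 - (star ψ ⬝ᵥ (momentumNumber k 0 *ᵥ ψ)).re) := by
  refine Real.le_sqrt_of_sq_le ?_
  rw [norm_toLp_conjTranspose_pairMode_mulVec_sq]
  have := (re_expect_pairAbsent_mem_Icc k ψ).2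
  rwa [h1, Complex.one_re] at this

/-- **Triangle bound for the pair operator**: `‖B(ĝ,S) ψ‖ ≤ Σ_{k∈S} |ĝ(k)| · ‖b_k ψ‖`. [folklore] -/
theorem norm_toLp_pairOperator_mulVec_le (ĝ : TorusSite 2 L → ℝ) (S : Finset (TorusSite 2 L))
    (ψ : Fock (Orb (FermionTorus 2 L))) :
    ‖(WithLp.toLp 2 (pairOperator ĝ S *ᵥ ψ) : EuclideanSpace ℂ (Finset (Orb (FermionTorus 2 L))))‖ ≤
      ∑ k ∈ S, |ĝ k| *
        ‖(WithLp.toLp 2 (pairMode k *ᵥ ψ) : EuclideanSpace ℂ (Finset (Orb (FermionTorus 2 L))))‖ := by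
  rw [pairOperator, Matrix.sum_mulVec, WithLp.toLp_sum]
  refine (norm_sum_le _ _).trans (le_of_eq (Finset.sum_congr rfl fun k _ => ?_))
  rw [Matrix.smul_mulVec, WithLp.toLp_smul, norm_smul, Complex.norm_real, Real.norm_eq_abs]

/-- **Triangle bound for the adjoint pair operator**: `‖B(ĝ,S)† ψ‖ ≤ Σ_{k∈S} |ĝ(k)| · ‖b_k† ψ‖`.
[folklore] -/
theorem norm_toLp_conjTranspose_pairOperator_mulVec_le (ĝ : TorusSite 2 L → ℝ)
    (S : Finset (TorusSite 2 L)) (ψ : Fock (Orb (FermionTorus 2 L))) :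
    ‖(WithLp.toLp 2 ((pairOperator ĝ S)ᴴ *ᵥ ψ) : EuclideanSpace ℂ (Finset (Orb (FermionTorus 2 L))))‖ ≤
      ∑ k ∈ S, |ĝ k| *
        ‖(WithLp.toLp 2 ((pairMode k)ᴴ *ᵥ ψ) : EuclideanSpace ℂ (Finset (Orb (FermionTorus 2 L))))‖ := by
  have hct : (pairOperator ĝ S)ᴴ = ∑ k ∈ S, (ĝ k : ℂ) • (pairMode k)ᴴ := by
    simp only [pairOperator, conjTranspose_sum, conjTranspose_smul, Complex.star_def,
      Complex.conj_ofReal]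
  rw [hct, Matrix.sum_mulVec, WithLp.toLp_sum]
  refine (norm_sum_le _ _).trans (le_of_eq (Finset.sum_congr rfl fun k _ => ?_))
  rw [Matrix.smul_mulVec, WithLp.toLp_smul, norm_smul, Complex.norm_real, Real.norm_eq_abs]

/-- **Above the Fermi set**: `‖B(ĝ,S) ψ‖ ≤ G Σ_{k∈S} √x_k` for `|ĝ| ≤ G`. [folklore] -/
theorem norm_toLp_pairOperator_mulVec_le_sum_sqrt {ĝ : TorusSite 2 L → ℝ} {G : ℝ}
    (hG : ∀ k, |ĝ k| ≤ G) (S : Finset (TorusSite 2 L)) (ψ : Fock (Orb (FermionTorus 2 L))) :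
    ‖(WithLp.toLp 2 (pairOperator ĝ S *ᵥ ψ) : EuclideanSpace ℂ (Finset (Orb (FermionTorus 2 L))))‖ ≤
      G * ∑ k ∈ S, Real.sqrt ((star ψ ⬝ᵥ (momentumNumber k 0 *ᵥ ψ)).re) := by
  refine (norm_toLp_pairOperator_mulVec_le ĝ S ψ).trans ?_
  rw [Finset.mul_sum]
  exact Finset.sum_le_sum fun k _ => mul_le_mul (hG k) (norm_toLp_pairMode_mulVec_le_sqrt k ψ)
    (norm_nonneg _) ((abs_nonneg _).trans (hG k))

/-- **Below the Fermi set**: for a unit vector `ψ` and `|ĝ| ≤ G`,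
`‖B(ĝ,S) ψ‖ ≤ G Σ_{k∈S} √(1 - x_k) + G √(Σ_{k∈S} x_k)` (adjoint triangle bound and the commutator
identity: `‖Bψ‖² = ‖B†ψ‖² + Σ_S ĝ²(x_k + y_k - 1) ≤ ‖B†ψ‖² + G² Σ_S x_k`). [folklore] -/
theorem norm_toLp_pairOperator_mulVec_le_sum_sqrt_one_sub {ĝ : TorusSite 2 L → ℝ} {G : ℝ}
    (hG : ∀ k, |ĝ k| ≤ G) (S : Finset (TorusSite 2 L)) {ψ : Fock (Orb (FermionTorus 2 L))}
    (h1 : star ψ ⬝ᵥ ψ = 1) :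
    ‖(WithLp.toLp 2 (pairOperator ĝ S *ᵥ ψ) : EuclideanSpace ℂ (Finset (Orb (FermionTorus 2 L))))‖ ≤
      G * ∑ k ∈ S, Real.sqrt (1 - (star ψ ⬝ᵥ (momentumNumber k 0 *ᵥ ψ)).re) +
        G * Real.sqrt (∑ k ∈ S, (star ψ ⬝ᵥ (momentumNumber k 0 *ᵥ ψ)).re) := by
  set x : TorusSite 2 L → ℝ := fun k => (star ψ ⬝ᵥ (momentumNumber k 0 *ᵥ ψ)).re with hx
  have hx0 : ∀ k, 0 ≤ x k := fun k => (re_expect_momentumNumber_mem_Icc k 0 ψ).1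
  have hy1 : ∀ k : TorusSite 2 L, (star ψ ⬝ᵥ (momentumNumber (-k) 1 *ᵥ ψ)).re ≤ 1 := fun k => by
    have := (re_expect_momentumNumber_mem_Icc (-k) 1 ψ).2
    rwa [h1, Complex.one_re] at this
  have hG0 : 0 ≤ G := (abs_nonneg _).trans (hG 0)
  -- `‖Bψ‖² = ‖B†ψ‖² + Σ ĝ² (x + y - 1) ≤ ‖B†ψ‖² + G² Σ x`
  set nB : ℝ := ‖(WithLp.toLp 2 (pairOperator ĝ S *ᵥ ψ) :
    EuclideanSpace ℂ (Finset (Orb (FermionTorus 2 L))))‖ with hnB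
  set nA : ℝ := ‖(WithLp.toLp 2 ((pairOperator ĝ S)ᴴ *ᵥ ψ) :
    EuclideanSpace ℂ (Finset (Orb (FermionTorus 2 L))))‖ with hnA
  have hB2 : nB ^ 2 = (star ψ ⬝ᵥ (((pairOperator ĝ S)ᴴ * pairOperator ĝ S) *ᵥ ψ)).re := by
    rw [hnB, norm_toLp_sq_eq_re, ← star_dotProduct_conjTranspose_mul_mulVec]
  have hA2 : nA ^ 2 = (star ψ ⬝ᵥ ((pairOperator ĝ S * (pairOperator ĝ S)ᴴ) *ᵥ ψ)).re := by
    rw [hnA, norm_toLp_sq_eq_re, ← star_dotProduct_conjTranspose_mul_mulVec, conjTranspose_conjTranspose]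
  have hsq : nB ^ 2 ≤ nA ^ 2 + G ^ 2 * ∑ k ∈ S, x k := by
    rw [hB2, hA2, re_expect_conjTranspose_pairOperator_mul_eq, h1, Complex.one_re, Finset.mul_sum]
    refine add_le_add le_rfl (Finset.sum_le_sum fun k _ => ?_)
    have hg2 : ĝ k ^ 2 ≤ G ^ 2 := by
      rw [← sq_abs (ĝ k)]
      exact pow_le_pow_left₀ (abs_nonneg _) (hG k) 2
    have hk := hy1 k
    have hxk := hx0 k
    show ĝ k ^ 2 * (x k + (star ψ ⬝ᵥ (momentumNumber (-k) 1 *ᵥ ψ)).re - 1) ≤ G ^ 2 * x k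
    nlinarith [sq_nonneg (ĝ k)]
  -- `‖B†ψ‖ ≤ G Σ √(1 - x)`
  have hA : nA ≤ G * ∑ k ∈ S, Real.sqrt (1 - x k) := by
    refine (norm_toLp_conjTranspose_pairOperator_mulVec_le ĝ S ψ).trans ?_
    rw [Finset.mul_sum]
    exact Finset.sum_le_sum fun k _ => mul_le_mul (hG k)
      (norm_toLp_conjTranspose_pairMode_mulVec_le_sqrt k h1) (norm_nonneg _) hG0
  have hA0 : 0 ≤ nA := norm_nonneg _
  have hB0 : 0 ≤ nB := norm_nonneg _
  have hS0 : 0 ≤ ∑ k ∈ S, x k := Finset.sum_nonneg fun k _ => hx0 k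
  set R : ℝ := Real.sqrt (∑ k ∈ S, x k) with hR
  have hR2 : R ^ 2 = ∑ k ∈ S, x k := Real.sq_sqrt hS0
  have hR0 : 0 ≤ R := Real.sqrt_nonneg _
  -- `nB ≤ nA + G R` since `nB² ≤ nA² + (G R)² ≤ (nA + G R)²`
  have hle : nB ≤ nA + G * R := by
    have h2 : nB ^ 2 ≤ (nA + G * R) ^ 2 := by
      calc nB ^ 2 ≤ nA ^ 2 + G ^ 2 * ∑ k ∈ S, x k := hsq
        _ = nA ^ 2 + (G * R) ^ 2 := by rw [mul_pow, hR2]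
        _ ≤ (nA + G * R) ^ 2 := by nlinarith [mul_nonneg hA0 (mul_nonneg hG0 hR0)]
    exact le_of_pow_le_pow_left₀ two_ne_zero (by nlinarith [mul_nonneg hG0 hR0]) h2
  linarith

/-! ### Pair amplitude against occupation deviations -/

/-- **Pair amplitude against deviations from a Fermi set.** For a unit vector `ψ`, a real form
factor with `|ĝ| ≤ G`, and ANY finite set `F` of momenta:
`√(Re ⟨ψ, B(ĝ)†B(ĝ) ψ⟩) ≤ G Σ_{k∉F} √x_k + G Σ_{k∈F} √(1 - x_k) + G √(Σ_{k∈F} x_k)`,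
`B(ĝ) = pairOperator ĝ univ`, `x_k = Re ⟨ψ, n_{k↑} ψ⟩` (`B(ĝ) = B(ĝ,Fᶜ) + B(ĝ,F)`, triangle
inequality, then the bounds above/below the Fermi set). The BCS amplitude `Σ_k ĝ(k) u_k v_k` has
exactly this size. Bardeen–Cooper–Schrieffer (1957) §II; Yang (1962) §3. [folklore] -/
theorem sqrt_re_expect_pairOperator_le_deviation {ĝ : TorusSite 2 L → ℝ} {G : ℝ}
    (hG : ∀ k, |ĝ k| ≤ G) (F : Finset (TorusSite 2 L)) {ψ : Fock (Orb (FermionTorus 2 L))}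
    (h1 : star ψ ⬝ᵥ ψ = 1) :
    Real.sqrt ((star ψ ⬝ᵥ (((pairOperator ĝ univ)ᴴ * pairOperator ĝ univ) *ᵥ ψ)).re) ≤
      G * ∑ k ∈ Fᶜ, Real.sqrt ((star ψ ⬝ᵥ (momentumNumber k 0 *ᵥ ψ)).re) +
        G * ∑ k ∈ F, Real.sqrt (1 - (star ψ ⬝ᵥ (momentumNumber k 0 *ᵥ ψ)).re) +
          G * Real.sqrt (∑ k ∈ F, (star ψ ⬝ᵥ (momentumNumber k 0 *ᵥ ψ)).re) := by
  have hsplit : pairOperator ĝ (univ : Finset (TorusSite 2 L)) = pairOperator ĝ Fᶜ + pairOperator ĝ F := by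
    rw [pairOperator, pairOperator, pairOperator, ← Finset.sum_add_sum_compl F, add_comm]
  have hnorm : Real.sqrt ((star ψ ⬝ᵥ (((pairOperator ĝ univ)ᴴ * pairOperator ĝ univ) *ᵥ ψ)).re) =
      ‖(WithLp.toLp 2 (pairOperator ĝ univ *ᵥ ψ) : EuclideanSpace ℂ (Finset (Orb (FermionTorus 2 L))))‖ := by
    rw [star_dotProduct_conjTranspose_mul_mulVec, ← norm_toLp_sq_eq_re, Real.sqrt_sq (norm_nonneg _)]
  rw [hnorm, hsplit, add_mulVec, WithLp.toLp_add]
  refine (norm_add_le _ _).trans ?_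
  have hab := norm_toLp_pairOperator_mulVec_le_sum_sqrt hG Fᶜ ψ
  have hbe := norm_toLp_pairOperator_mulVec_le_sum_sqrt_one_sub hG F h1
  linarith

/-- **`d`-wave form.** For a unit vector `ψ` with `Re ⟨ψ, Δ_d†Δ_d ψ⟩ ≥ a·L⁴` and ANY finite set `F`
of momenta: `√(a/8)·L² ≤ 2 Σ_{k∉F} √x_k + 2 Σ_{k∈F} √(1 - x_k) + 2 √(Σ_{k∈F} x_k)`
(`Δ_d†Δ_d = 8 B(ĝ_d)†B(ĝ_d)`, `|ĝ_d| ≤ 2`). Bardeen–Cooper–Schrieffer (1957) §II. [folklore] -/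
theorem sqrt_le_deviation_of_le_re_expect_pairField_dWave {a : ℝ} (F : Finset (TorusSite 2 L))
    {ψ : Fock (Orb (FermionTorus 2 L))} (h1 : star ψ ⬝ᵥ ψ = 1)
    (hY : a * (L : ℝ) ^ 4 ≤
      (star ψ ⬝ᵥ (((pairField dWaveFormFactor L)ᴴ * pairField dWaveFormFactor L) *ᵥ ψ)).re) :
    Real.sqrt (a / 8) * (L : ℝ) ^ 2 ≤
      2 * ∑ k ∈ Fᶜ, Real.sqrt ((star ψ ⬝ᵥ (momentumNumber k 0 *ᵥ ψ)).re) +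
        2 * ∑ k ∈ F, Real.sqrt (1 - (star ψ ⬝ᵥ (momentumNumber k 0 *ᵥ ψ)).re) +
          2 * Real.sqrt (∑ k ∈ F, (star ψ ⬝ᵥ (momentumNumber k 0 *ᵥ ψ)).re) := by
  have hg : ∀ k : TorusSite 2 L, |dWaveGap k| ≤ 2 := fun k => by
    unfold dWaveGap
    have ha := Real.abs_cos_le_one (latticeMomentum L k 0)
    have hb := Real.abs_cos_le_one (latticeMomentum L k 1)
    calc |Real.cos (latticeMomentum L k 0) - Real.cos (latticeMomentum L k 1)|
        ≤ |Real.cos (latticeMomentum L k 0)| + |Real.cos (latticeMomentum L k 1)| := abs_sub _ _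
      _ ≤ 2 := by linarith
  have h := sqrt_re_expect_pairOperator_le_deviation hg F h1
  set Q : ℝ := (star ψ ⬝ᵥ (((pairOperator dWaveGap univ)ᴴ * pairOperator dWaveGap univ) *ᵥ ψ)).re with hQ
  have hYQ : (star ψ ⬝ᵥ (((pairField dWaveFormFactor L)ᴴ * pairField dWaveFormFactor L) *ᵥ ψ)).re = 8 * Q := by
    rw [conjTranspose_pairField_dWave_mul_self, Matrix.smul_mulVec, dotProduct_smul, smul_eq_mul,
      Complex.re_ofReal_mul]
  rw [hYQ] at hY
  have hL4 : (0 : ℝ) ≤ (L : ℝ) ^ 4 := by positivity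
  have haQ : a / 8 * ((L : ℝ) ^ 2) ^ 2 ≤ Q := by nlinarith
  have hs : Real.sqrt (a / 8) * (L : ℝ) ^ 2 ≤ Real.sqrt Q := by
    by_cases ha : 0 ≤ a / 8
    · rw [← Real.sqrt_sq (show (0 : ℝ) ≤ (L : ℝ) ^ 2 by positivity), ← Real.sqrt_mul ha]
      exact Real.sqrt_le_sqrt haQ
    · push Not at ha
      rw [Real.sqrt_eq_zero'.2 ha.le, zero_mul]
      exact Real.sqrt_nonneg _
  exact hs.trans h

end Literature.MathematicalPhysics.QuantumLattice
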